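/-
Copyright: cell pub-balaban-gaps, seat ne8 (estimate NE7c), gen 18. Project licence.
-/
import Summits.QuantumFields.BalabanUV.T4Continuum.Spine.NE7c.LiveFactorJointLawModel

/-!
# Road (δ)'s END-TO-END constructor on the TWO RUNS «`K` averaging steps» vs «`K + 1` averaging steps» of ONE Wilson–Gibbs field:
# the laws of the block-averaged fields `Ū^K = M^K(U)` and `Ū^{K+1}` ([B12] (0.11)∕(0.21), `Setup.Averaging.iter`) under ANY measurable family of
# Bałaban averaging operations, `S` plaquette tests of the averaged fields per run — `T4IndicatorShell.ShellWeightBound` BY NAME with `V = S` and the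
# ceiling `(S·4c₁∕β′)·ϑ^K` under both laws (row NE7c; junction J-25b; LATTICE MODEL, [folklore])

Cell `pub-balaban-gaps` (G2), seat ne8, estimate **NE7c** (`T4IndicatorShell.ShellWeightBound`; two-run artefact, NOT PRINTED in [Bałaban 1983–89], NOT
PROVED).  Proof-only file under `Spine/NE7c/`: imports this seat's file 47 `LiveFactorJointLawModel` only (J-25: `shellWeightBound_jointLaw` — ANY
probability space per run and `K`, `S` measurable tested observables arbitrarily dependent, `V = S`; through it the tree's `T4ShellMeasure`,
`T4GenFunBounds.gibbsMeasure`, `Setup.Averaging`, `Missing.measurable_plaqHol`).  Nothing of Bałaban's is named beyond the DEFINITIONS `Setup.Averaging` ∕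
`Averaging.iter` ([B7] (15), [B12] (0.4)∕(0.11)), `GaugeField.plaqHol`, `reTr` ([B12] (0.2)); no `def`; 0 `sorry`.

THE QUESTION (file 47 §3 compared the Wilson–Gibbs measures of two CONSECUTIVE LATTICES of a torus scheme; NE7c's two runs are «`K` steps» and
«`K + 1` steps» of Bałaban's iteration on ONE field).  Does road (δ)'s typed constructor fire on the two runs read as the `K`-fold and the `(K+1)`-fold
BLOCK-AVERAGED FIELD of one interacting Wilson–Gibbs field — the push-forwards `(gibbsMeasure Pm β).map (Averaging.iter av K)`, i.e. the renormalized
densities `T^K e^{−βA}` of [B7] (10) ∕ [B12] (0.13) in the push-forward reading `Setup.IsRT`, taken as MEASURES on `GaugeField Pm K G`?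

ANSWER ([folklore]): yes, for EVERY measurable family `av : ∀ j, Averaging Pm j G` (the type is inhabited by the axial average `AveragingRT.axial`, measurable
by `AveragingRT.measurable_axialAvg`; Bałaban's weighted average (0.12) is not constructed in the tree — DIVERGENCE F6), every `β ≥ 0`, every regular `G`,
any `S` plaquettes per level: `measurable_iter` (the iterate is measurable, induction) and **`shellWeightBound_averagedRuns`** (file 47's
`shellWeightBound_jointLaw` at `Ω^A_K = GaugeField Pm K G`, `P^A_K = (gibbsMeasure Pm β).map (iter av K)`, `Ω^B_K = GaugeField Pm (K+1) G`,
`P^B_K = (gibbsMeasure Pm β).map (iter av (K+1))`, tests `1 − Re tr V(∂p)` of the averaged fields; `Measure.isProbabilityMeasure_map`).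

WHAT THIS SHOWS ∕ DOES NOT SHOW (honest).  SHOWS: road (δ)'s chain fires on the laws of Bałaban's AVERAGED FIELDS `Ū^K`, `Ū^{K+1}` of one Wilson–Gibbs field,
for any typed averaging family — ONE common live factor per `K`, total two-sided shell mass of the battery `≤ (S·4c₁∕β′)·ϑ^K` under BOTH laws, by
σ-additivity alone.  DOES NOT SHOW: anything about the effective DENSITIES' adaptive small∕large-field decomposition [B14] (2.18) (node O), the
minimisers `U_k(V)` tested in (2.17) (the tests here are on the averaged field itself — [B14]'s `U_{k,□}(V_k)` at `k = 0` only), (L1-step), or two-run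
closeness (U1b ∕ NE3: the radii `ρ^X` are free).  BY-NAME EFFECT ON THE WALL: none (MODEL).  VERDICT WORD UNCHANGED: WORK-bound behind node O; INSTANCE 0∕1.
NE7c ∕ NE7b NOT PRINTED ∕ NOT PROVED; spine 0∕9; one finite T⁴ — NOT ℝ⁴, NOT infinite volume, NOT the mass gap, NOT Clay.
HONEST DEPENDENCY (cell): continuum YM on T⁴ ⇐ BetaPertH ∧ nine spine estimates (0∕9 proved); BetaPertH ⇐ (D1) ∧ (D4) ∧ CAP+tail.
-/

set_option autoImplicit false

noncomputable section

open MeasureTheory Finset Set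
open Literature.MathematicalPhysics.QuantumFieldTheory.Balaban1983to89
open Literature.MathematicalPhysics.QuantumFieldTheory.Balaban1983to89.T4ShellMeasure
open Summit.QuantumFields.BalabanUV.T4Continuum.Spine.NE7c.LiveFactorJointLawModel (shellWeightBound_jointLaw)

namespace Summit.QuantumFields.BalabanUV.T4Continuum.Spine.NE7c.LiveFactorAveragedRunsModel

/-! ## §4 The AVERAGED-RUNS instance: ONE Wilson–Gibbs field on `T^{(0)}`, block-averaged `K` times (run A) against `K + 1` times (run B) by ANY
measurable family of Bałaban averaging operations `Ū = M(U)` (`Setup.Averaging`, iterate `Averaging.iter` = [B12] (0.11)∕(0.21)), `S` plaquette tests of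
the averaged fields at levels `K` and `K + 1` -/

section Averaged

variable {G : Type*} [GaugeGroup G] [MeasurableSpace G] {Pm : Params} (av : ∀ j, Averaging Pm j G)

/-- The `k`-fold iterate `Ū^k = M^k(U)` of a family of measurable one-step averagings is measurable. [folklore] -/
theorem measurable_iter (hav : ∀ j, Measurable (av j).avg) : ∀ k, Measurable (Averaging.iter av k)
  | 0 => measurable_id
  | k + 1 => (hav k).comp (measurable_iter hav k)

variable [RegularGaugeGroup G] [HaarData G] (β : ℝ) {S : ℕ} (pA : ∀ K, Fin S → Plaq Pm K) (pB : ∀ K, Fin S → Plaq Pm (K + 1))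
  (θ ρA ρB : ℕ → Fin S → ℝ)

/-- **ROAD (δ)'s CONSTRUCTOR FIRES ON THE TWO RUNS «`K` AVERAGING STEPS» vs «`K + 1` AVERAGING STEPS» OF ONE WILSON–GIBBS FIELD.**  `G` any regular gauge
group, `Pm` any torus parameters, `β ≥ 0`; ONE interacting field `U` under Wilson's Gibbs measure `T4GenFunBounds.gibbsMeasure Pm β` on `T^{(0)}`;
`av : ∀ j, Averaging Pm j G` ANY family of Bałaban block-averaging operations ([B7] (15) ∕ [B12] (0.4): gauge covariance + locality as typed in `Setup`;
inhabited by the axial average `AveragingRT.axial`, measurable by `AveragingRT.measurable_axialAvg`) with measurable steps.  The `K`-th comparison: run A =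
the LAW of the `K`-fold averaged field `Ū^K = Averaging.iter av K U` on `GaugeField Pm K G` (the push-forward `(gibbsMeasure Pm β).map (iter av K)` —
the renormalized density `T^K e^{−βA}` of [B7] (10) ∕ [B12] (0.13) in the push-forward reading `Setup.IsRT`, as a MEASURE), run B = the law of `Ū^{K+1}`
on `GaugeField Pm (K + 1) G`; tests = the plaquette action densities `1 − Re tr Ū^K(∂p^A_{K,σ})` resp. `1 − Re tr Ū^{K+1}(∂p^B_{K,σ})` of `S` chosen
plaquettes of `T^{(K)}` resp. `T^{(K+1)}` against `θ_{K,σ}·(1 − c₁ϑ^K)^i`.  Conclusion (§2 BY NAME): ONE common live factor index `i⋆ K` per `K` with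
`Σ_σ P{1 − Re tr Ū^K(∂p^A_σ) ∈ shell_{i⋆K}} ≤ (S·4c₁∕β′)·ϑ^K`, the same for `Ū^{K+1}`, and `T4IndicatorShell.ShellWeightBound` with `V = S`.  MODEL: the
averaged FIELDS of the two runs are compared through a FIXED battery; Bałaban's effective DENSITIES with their adaptive small∕large-field decompositions
([B14] (2.18)) are node O. [folklore] -/
theorem shellWeightBound_averagedRuns (hβ : 0 ≤ β) (hav : ∀ j, Measurable (av j).avg) (l₀ : ℝ) {c₁ β' ϑ : ℝ} (hc₁ : 0 < c₁) (h2 : 2 * c₁ ≤ β')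
    (hβ1 : β' ≤ 1) (hϑ0 : 0 < ϑ) (hϑ1 : ϑ < 1) (hθ : ∀ K σ, 0 ≤ θ K σ)
    (hA0 : ∀ K σ, 0 ≤ ρA K σ) (hA2 : ∀ K σ, 2 * ρA K σ ≤ c₁ * ϑ ^ K) (hB0 : ∀ K σ, 0 ≤ ρB K σ) (hB2 : ∀ K σ, 2 * ρB K σ ≤ c₁ * ϑ ^ K) :
    ∃ istar : ℕ → ℕ, (∀ K, istar K < ⌊β' / (c₁ * ϑ ^ K)⌋₊ ∧
        ∑ σ, ((T4GenFunBounds.gibbsMeasure (G := G) Pm β).map (Averaging.iter av K)).real ((fun V : GaugeField Pm K G => 1 - reTr (GaugeField.plaqHol V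
            (pA K σ))) ⁻¹' twoSidedShell (θ K σ) (c₁ * ϑ ^ K) (ρA K σ) (istar K)) ≤ ((S : ℝ) * (4 * c₁ / β')) * ϑ ^ K ∧
        ∑ σ, ((T4GenFunBounds.gibbsMeasure (G := G) Pm β).map (Averaging.iter av (K + 1))).real ((fun V : GaugeField Pm (K + 1) G => 1 - reTr (GaugeField.plaqHol V
            (pB K σ))) ⁻¹' twoSidedShell (θ K σ) (c₁ * ϑ ^ K) (ρB K σ) (istar K)) ≤ ((S : ℝ) * (4 * c₁ / β')) * ϑ ^ K) ∧
      T4IndicatorShell.ShellWeightBound l₀ (fun _ => (univ : Finset (Fin S → Bool)))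
        (fun K (_ : ℝ) (ω : Fin S → Bool) => ((T4GenFunBounds.gibbsMeasure (G := G) Pm β).map (Averaging.iter av K)).real (⋂ τ, (fun V : GaugeField Pm K G => 1 - reTr
            (GaugeField.plaqHol V (pA K τ))) ⁻¹' (if ω τ then Iio (θ K τ * (1 - c₁ * ϑ ^ K) ^ istar K) else Ici (θ K τ * (1 - c₁ * ϑ ^ K) ^ istar K))))
        (fun K (_ : ℝ) (ω : Fin S → Bool) => ((T4GenFunBounds.gibbsMeasure (G := G) Pm β).map (Averaging.iter av (K + 1))).real (⋂ τ, (fun V : GaugeField Pm (K + 1) G => 1 - reTr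
            (GaugeField.plaqHol V (pB K τ))) ⁻¹' (if ω τ then Iio (θ K τ * (1 - c₁ * ϑ ^ K) ^ istar K) else Ici (θ K τ * (1 - c₁ * ϑ ^ K) ^ istar K))))
        (fun K (_ : ℝ) (ω : Fin S → Bool) =>
          ((T4GenFunBounds.gibbsMeasure (G := G) Pm β).map (Averaging.iter av K)).real ((⋂ τ, (fun V : GaugeField Pm K G => 1 - reTr (GaugeField.plaqHol V (pA K τ))) ⁻¹'
              (if ω τ then Iio (θ K τ * (1 - c₁ * ϑ ^ K) ^ istar K) else Ici (θ K τ * (1 - c₁ * ϑ ^ K) ^ istar K))) ∩ ⋃ σ, (fun V : GaugeField Pm K G => 1 - reTr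
                  (GaugeField.plaqHol V (pA K σ))) ⁻¹' twoSidedShell (θ K σ) (c₁ * ϑ ^ K) (ρA K σ) (istar K)))
        (fun K (_ : ℝ) (ω : Fin S → Bool) =>
          ((T4GenFunBounds.gibbsMeasure (G := G) Pm β).map (Averaging.iter av (K + 1))).real ((⋂ τ, (fun V : GaugeField Pm (K + 1) G => 1 - reTr (GaugeField.plaqHol V
              (pB K τ))) ⁻¹' (if ω τ then Iio (θ K τ * (1 - c₁ * ϑ ^ K) ^ istar K) else Ici (θ K τ * (1 - c₁ * ϑ ^ K) ^ istar K))) ∩ ⋃ σ, (fun V : GaugeField Pm (K + 1) G =>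
                  1 - reTr (GaugeField.plaqHol V (pB K σ))) ⁻¹' twoSidedShell (θ K σ) (c₁ * ϑ ^ K) (ρB K σ) (istar K)))
        (fun K => ∑ σ, ((T4GenFunBounds.gibbsMeasure (G := G) Pm β).map (Averaging.iter av K)).real ((fun V : GaugeField Pm K G => 1 - reTr (GaugeField.plaqHol V
            (pA K σ))) ⁻¹' twoSidedShell (θ K σ) (c₁ * ϑ ^ K) (ρA K σ) (istar K)) + ∑ σ, ((T4GenFunBounds.gibbsMeasure (G := G) Pm β).map (Averaging.iter av (K + 1))).real
                ((fun V : GaugeField Pm (K + 1) G => 1 - reTr (GaugeField.plaqHol V (pB K σ))) ⁻¹' twoSidedShell (θ K σ) (c₁ * ϑ ^ K) (ρB K σ) (istar K))) := by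
  haveI : IsProbabilityMeasure (T4GenFunBounds.gibbsMeasure (G := G) Pm β) := T4GenFunBounds.isProbabilityMeasure_gibbsMeasure _ hβ
  haveI hI : ∀ K, IsProbabilityMeasure ((T4GenFunBounds.gibbsMeasure (G := G) Pm β).map (Averaging.iter av K)) :=
    fun K => Measure.isProbabilityMeasure_map (measurable_iter av hav K).aemeasurable
  haveI : ∀ K, IsProbabilityMeasure ((T4GenFunBounds.gibbsMeasure (G := G) Pm β).map (Averaging.iter av (K + 1))) := fun K => hI (K + 1)
  exact shellWeightBound_jointLaw (ΩA := fun K => GaugeField Pm K G) (ΩB := fun K => GaugeField Pm (K + 1) G)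
    (fun K => (T4GenFunBounds.gibbsMeasure (G := G) Pm β).map (Averaging.iter av K))
    (fun K => (T4GenFunBounds.gibbsMeasure (G := G) Pm β).map (Averaging.iter av (K + 1)))
    (fun K σ (V : GaugeField Pm K G) => 1 - reTr (GaugeField.plaqHol V (pA K σ)))
    (fun K σ (V : GaugeField Pm (K + 1) G) => 1 - reTr (GaugeField.plaqHol V (pB K σ))) θ ρA ρB l₀ hc₁ h2 hβ1 hϑ0 hϑ1
    (fun K σ => measurable_const.sub (RegularGaugeGroup.measurable_reTr.comp (Missing.measurable_plaqHol (pA K σ))))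
    (fun K σ => measurable_const.sub (RegularGaugeGroup.measurable_reTr.comp (Missing.measurable_plaqHol (pB K σ)))) hθ hA0 hA2 hB0 hB2

end Averaged

end Summit.QuantumFields.BalabanUV.T4Continuum.Spine.NE7c.LiveFactorAveragedRunsModel

end
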